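import Summits.CriticalPhenomena.Ising3DConformalLimit.Theses.PerfectScreening
import Literature.Probability.LatticeModels.HighDimPointwiseTriviality

/-!
# `CoulombImpliesNontrivial` (item stmt-CriticalPhenomena-13885): under the antecedent every limit two-point function is two-sided Coulomb

Negative/structural knowledge about the crux `…Theses.PerfectScreening.CoulombImpliesNontrivial`
(route PerfectScreening, r3), from its standing crux disprover (D-0016); THEOREM-ONLY, no new definitions.

`limit_twoPoint_coulomb`: if `c/‖x‖ ≤ ⟨σ₀σ_x⟩_{β_c(3)}` off the origin (the antecedent of r3), then for
EVERY pointwise scaling limit `S` of the critical correlators with non-degenerate two-point function (any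
renormalisation `ρ`) there are constants `c', C' > 0` with
`c'/‖z₁ - z₀‖_∞ ≤ S₂(z₀, z₁) ≤ C'/‖z₁ - z₀‖_∞` on all non-coincident pairs. Ingredients: the tree's
`exists_eventually_inv_sq_rho_le` (`ρ(δ)² ≳ δ⁻¹`, infrared bound) and its mirror image under the Coulomb
lower bound (`rho_sq_le_of_coulomb`: `ρ(δ)² ≲ δ⁻¹`), plus the `2δ`-accuracy of rescaled lattice
approximations. Read together with `not_twoPointOnly` (`LoadBearing.lean`): the antecedent places every
limit exactly in the class (non-degenerate, two-sided Coulomb two-point function) in which `U₄ ≡ 0` is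
possible (massless free field) — the lattice clause must do all the work.
-/

noncomputable section

namespace Summit.CriticalPhenomena.Ising3DConformalLimit.CoulombImpliesNontrivialNegative

open Literature.Probability.LatticeModels Filter Set
open Summit.CriticalPhenomena.Ising3DConformalLimit.Theses
open scoped Topology

/-! ### Lattice approximations of a pair: `δ·‖[z₁/δ] - [z₀/δ]‖_∞ = ‖z₁ - z₀‖_∞ ± 2δ` -/

/-- `δ·‖[q/δ] - [p/δ]‖_∞ ≤ ‖q - p‖_∞ + 2δ` for `δ > 0`. [folklore] -/
theorem mul_supNorm_sub_le {δ : ℝ} (hδ : 0 < δ) (p q : EuclideanSpace ℝ (Fin 3)) :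
    δ * (Site.supNorm (latticeApprox δ q - latticeApprox δ p) : ℝ) ≤
      ‖WithLp.ofLp q - WithLp.ofLp p‖ + 2 * δ := by
  set v := latticeApprox δ q - latticeApprox δ p with hv
  have hB : 0 ≤ (‖WithLp.ofLp q - WithLp.ofLp p‖ + 2 * δ) / δ := by positivity
  have hle : ‖v‖ ≤ (‖WithLp.ofLp q - WithLp.ofLp p‖ + 2 * δ) / δ := by
    refine (pi_norm_le_iff_of_nonneg hB).2 fun k => ?_
    rw [Int.norm_eq_abs, le_div_iff₀ hδ]
    have h1 := abs_mul_sub_latticeApprox_sub_le hδ q p k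
    have h2 : |q k - p k| ≤ ‖WithLp.ofLp q - WithLp.ofLp p‖ := by
      have := norm_le_pi_norm (WithLp.ofLp q - WithLp.ofLp p) k
      rwa [Pi.sub_apply, Real.norm_eq_abs] at this
    have hcast : ((v k : ℤ) : ℝ) = (latticeApprox δ q k : ℝ) - (latticeApprox δ p k : ℝ) := by
      rw [hv, Pi.sub_apply]; push_cast; ring
    rw [hcast]
    have h3 := abs_sub_abs_le_abs_sub (δ * ((latticeApprox δ q k : ℝ) - (latticeApprox δ p k : ℝ))) (q k - p k)
    rw [abs_mul, abs_of_pos hδ] at h3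
    nlinarith [abs_nonneg ((latticeApprox δ q k : ℝ) - (latticeApprox δ p k : ℝ))]
  rw [Site.norm_eq_supNorm] at hle
  have := mul_le_mul_of_nonneg_left hle hδ.le
  rwa [mul_div_cancel₀ _ hδ.ne'] at this

/-- `‖q - p‖_∞ - 2δ ≤ δ·‖[q/δ] - [p/δ]‖_∞` for `δ > 0`. [folklore] -/
theorem le_mul_supNorm_sub {δ : ℝ} (hδ : 0 < δ) (p q : EuclideanSpace ℝ (Fin 3)) :
    ‖WithLp.ofLp q - WithLp.ofLp p‖ - 2 * δ ≤
      δ * (Site.supNorm (latticeApprox δ q - latticeApprox δ p) : ℝ) := by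
  set v := latticeApprox δ q - latticeApprox δ p with hv
  have hB : 0 ≤ δ * (Site.supNorm v : ℝ) + 2 * δ := by positivity
  have hle : ‖WithLp.ofLp q - WithLp.ofLp p‖ ≤ δ * (Site.supNorm v : ℝ) + 2 * δ := by
    refine (pi_norm_le_iff_of_nonneg hB).2 fun k => ?_
    rw [Pi.sub_apply, Real.norm_eq_abs]
    have h1 := abs_mul_sub_latticeApprox_sub_le hδ q p k
    have h2 : |((v k : ℤ) : ℝ)| ≤ (Site.supNorm v : ℝ) := abs_coord_le_supNorm v k
    have hcast : ((v k : ℤ) : ℝ) = (latticeApprox δ q k : ℝ) - (latticeApprox δ p k : ℝ) := by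
      rw [hv, Pi.sub_apply]; push_cast; ring
    rw [hcast] at h2
    have h3 := abs_sub_abs_le_abs_sub (q k - p k) (δ * ((latticeApprox δ q k : ℝ) - (latticeApprox δ p k : ℝ)))
    rw [abs_sub_comm] at h1
    rw [abs_mul, abs_of_pos hδ] at h3
    nlinarith [mul_le_mul_of_nonneg_left h2 hδ.le]
  linarith

/-! ### The rescaled pair correlator -/

/-- The rescaled pair correlator is `ρ(δ)² ⟨σ₀σ_{[z₁/δ]-[z₀/δ]}⟩_{β_c}`. [folklore] -/
theorem rescaledCorrelator_two_eq (ρ : ℝ → ℝ) (δ : ℝ) (z : Fin 2 → EuclideanSpace ℝ (Fin 3)) :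
    rescaledCorrelator (criticalCorr 3) ρ 2 δ z =
      ρ δ ^ 2 * criticalTwoPoint 3 (latticeApprox δ (z 1) - latticeApprox δ (z 0)) := by
  rw [rescaledCorrelator_apply, latticeApprox_comp_two, criticalCorr_two_pair]

/-! ### Two-sided bounds on the renormalisation under the Coulomb law -/

/-- **The Coulomb lower bound forces `ρ(δ)² ≲ δ⁻¹`**: if `c/‖x‖ ≤ G` off `0` and the rescaled pair
correlator converges at one non-coincident pair, then `ρ(δ)² ≤ K/δ` for all small `δ > 0` (mirror image of
the tree's `exists_eventually_inv_sq_rho_le`, which gives `ρ(δ)² ≳ δ⁻¹` from the infrared bound). [folklore] -/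
theorem rho_sq_le_of_coulomb
    (hC : ∃ c : ℝ, 0 < c ∧ ∀ x : Site 3, x ≠ 0 → c / ‖x‖ ≤ criticalTwoPoint 3 x)
    {ρ : ℝ → ℝ} {S : CorrFamily 3} (hlim : HasPointwiseScalingLimit (criticalCorr 3) ρ S)
    {z₀ : Fin 2 → EuclideanSpace ℝ (Fin 3)} (hz₀ : z₀ ∈ NonCoincident 3 2) :
    ∃ K : ℝ, 0 < K ∧ ∀ᶠ δ in 𝓝[>] (0 : ℝ), ρ δ ^ 2 ≤ K / δ := by
  obtain ⟨c, hc, hcou⟩ := hC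
  set t : ℝ := ‖WithLp.ofLp (z₀ 1) - WithLp.ofLp (z₀ 0)‖ with ht
  have hinj : Function.Injective z₀ := hz₀
  have htpos : 0 < t := by
    rw [ht, norm_pos_iff, sub_ne_zero]
    exact fun h => absurd (hinj ((WithLp.ofLp_injective 2) h)) (by decide)
  have hconv := (hlim 2).tendsto_at hz₀
  have hev1 : ∀ᶠ δ in 𝓝[>] (0 : ℝ), rescaledCorrelator (criticalCorr 3) ρ 2 δ z₀ < |S 2 z₀| + 1 :=
    (tendsto_order.1 hconv).2 _ (by linarith [le_abs_self (S 2 z₀)])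
  have hev2 : ∀ᶠ δ in 𝓝[>] (0 : ℝ), δ < t / 4 :=
    (eventually_lt_nhds (by positivity : (0 : ℝ) < t / 4)).filter_mono nhdsWithin_le_nhds
  have hev3 : ∀ᶠ δ in 𝓝[>] (0 : ℝ), δ ∈ Set.Ioo (0:ℝ) 1 := Ioo_mem_nhdsGT one_pos
  refine ⟨(|S 2 z₀| + 1) * (t + 2) / c, by positivity, ?_⟩
  filter_upwards [hev1, hev2, hev3] with δ h1 h2 hδ
  set v := latticeApprox δ (z₀ 1) - latticeApprox δ (z₀ 0) with hv
  rw [rescaledCorrelator_two_eq] at h1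
  have hup : δ * (Site.supNorm v : ℝ) ≤ t + 2 * δ := mul_supNorm_sub_le hδ.1 (z₀ 0) (z₀ 1)
  have hlow : t - 2 * δ ≤ δ * (Site.supNorm v : ℝ) := le_mul_supNorm_sub hδ.1 (z₀ 0) (z₀ 1)
  have hvpos : (0:ℝ) < Site.supNorm v := by
    by_contra h0
    push Not at h0
    nlinarith [hδ.1]
  have hv0 : v ≠ 0 := by
    intro h0
    rw [h0, Site.supNorm_eq_zero_iff.2 rfl, Nat.cast_zero] at hvpos
    exact lt_irrefl _ hvpos
  -- G(v) ≥ c/‖v‖_∞ ≥ c δ/(t + 2δ) ≥ c δ/(t + 2)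
  have hG : c * δ / (t + 2) ≤ criticalTwoPoint 3 v := by
    have h := hcou v hv0
    rw [Site.norm_eq_supNorm] at h
    refine le_trans ?_ h
    rw [div_le_div_iff₀ (by positivity) hvpos]
    nlinarith [hδ.1, hδ.2]
  have hkey : ρ δ ^ 2 * (c * δ / (t + 2)) ≤ |S 2 z₀| + 1 :=
    (mul_le_mul_of_nonneg_left hG (sq_nonneg _)).trans h1.le
  have ht2 : (0:ℝ) < t + 2 := by positivity
  have h3 : ρ δ ^ 2 * (c * δ) ≤ (|S 2 z₀| + 1) * (t + 2) := by
    have := mul_le_mul_of_nonneg_right hkey ht2.le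
    rwa [mul_assoc, div_mul_cancel₀ _ ht2.ne'] at this
  rw [le_div_iff₀ hδ.1, le_div_iff₀ hc]
  calc ρ δ ^ 2 * δ * c = ρ δ ^ 2 * (c * δ) := by ring
    _ ≤ _ := h3

/-- A reference non-coincident pair `(0, e₀)` of `ℝ³`. [folklore] -/
theorem refPair_mem_nonCoincident' :
    (![0, EuclideanSpace.single (0 : Fin 3) (1:ℝ)] : Fin 2 → EuclideanSpace ℝ (Fin 3)) ∈ NonCoincident 3 2 := by
  refine pair_mem_nonCoincident fun h => ?_
  have := congrArg (fun v : EuclideanSpace ℝ (Fin 3) => v 0) h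
  simp at this

/-- **Under the antecedent of r3 the two-point function of EVERY non-degenerate pointwise limit is two-sided
Coulomb**: `c'/‖z₁ - z₀‖_∞ ≤ S₂(z₀,z₁) ≤ C'/‖z₁ - z₀‖_∞` on non-coincident pairs (sup norm of `ℝ³`), for
some constants `c', C' > 0` — exactly the hypothesis of the (false) continuum shadow `not_twoPointOnly`.
[folklore] -/
theorem limit_twoPoint_coulomb
    (hC : ∃ c : ℝ, 0 < c ∧ ∀ x : Site 3, x ≠ 0 → c / ‖x‖ ≤ criticalTwoPoint 3 x)
    {ρ : ℝ → ℝ} {S : CorrFamily 3} (hlim : HasPointwiseScalingLimit (criticalCorr 3) ρ S)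
    (hnd : IsNondegenerateTwoPoint S) :
    ∃ c' C' : ℝ, 0 < c' ∧ 0 < C' ∧ ∀ z ∈ NonCoincident 3 2,
      c' / ‖WithLp.ofLp (z 1) - WithLp.ofLp (z 0)‖ ≤ S 2 z ∧
        S 2 z ≤ C' / ‖WithLp.ofLp (z 1) - WithLp.ofLp (z 0)‖ := by
  have hz₀ := refPair_mem_nonCoincident'
  obtain ⟨K₁, hK₁⟩ := exists_eventually_inv_sq_rho_le (d := 3) le_rfl hlim hz₀ (hnd _ hz₀)
  obtain ⟨K₂, hK₂pos, hK₂⟩ := rho_sq_le_of_coulomb hC hlim hz₀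
  obtain ⟨c, hc, hcou⟩ := hC
  obtain ⟨C, hC0, hIR⟩ := exists_criticalTwoPoint_le_inv_pow (d := 3) le_rfl
  set A : ℝ := |K₁| + 1 with hA
  have hApos : 0 < A := by positivity
  refine ⟨c / (2 * A), 2 * K₂ * (C + 1), by positivity, by positivity, fun z hz => ?_⟩
  set m : ℝ := ‖WithLp.ofLp (z 1) - WithLp.ofLp (z 0)‖ with hm
  have hinj : Function.Injective z := hz
  have hmpos : 0 < m := by
    rw [hm, norm_pos_iff, sub_ne_zero]
    exact fun h => absurd (hinj ((WithLp.ofLp_injective 2) h)) (by decide)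
  have hconv : Tendsto (fun δ => ρ δ ^ 2 * criticalTwoPoint 3 (latticeApprox δ (z 1) - latticeApprox δ (z 0)))
      (𝓝[>] 0) (𝓝 (S 2 z)) := by
    refine ((hlim 2).tendsto_at hz).congr fun δ => ?_
    exact rescaledCorrelator_two_eq ρ δ z
  have hev2 : ∀ᶠ δ in 𝓝[>] (0 : ℝ), δ < m / 4 :=
    (eventually_lt_nhds (by positivity : (0 : ℝ) < m / 4)).filter_mono nhdsWithin_le_nhds
  have hev3 : ∀ᶠ δ in 𝓝[>] (0 : ℝ), δ ∈ Set.Ioo (0:ℝ) 1 := Ioo_mem_nhdsGT one_pos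
  -- common geometric facts, eventually
  have hgeom : ∀ᶠ δ in 𝓝[>] (0 : ℝ), 0 < δ ∧ δ < m / 4 ∧
      m / 2 ≤ δ * (Site.supNorm (latticeApprox δ (z 1) - latticeApprox δ (z 0)) : ℝ) ∧
      δ * (Site.supNorm (latticeApprox δ (z 1) - latticeApprox δ (z 0)) : ℝ) ≤ 2 * m ∧
      latticeApprox δ (z 1) - latticeApprox δ (z 0) ≠ 0 := by
    filter_upwards [hev2, hev3] with δ h2 hδ
    have hup := mul_supNorm_sub_le hδ.1 (z 0) (z 1)
    have hlow := le_mul_supNorm_sub hδ.1 (z 0) (z 1)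
    refine ⟨hδ.1, h2, by linarith, by linarith, fun h0 => ?_⟩
    rw [h0, Site.supNorm_eq_zero_iff.2 rfl, Nat.cast_zero, mul_zero] at hlow
    linarith
  constructor
  · -- lower bound: ρ² ≥ 1/(A δ), G ≥ c/‖v‖ ≥ c δ/(2m)
    refine ge_of_tendsto hconv ?_
    filter_upwards [hgeom, hK₁] with δ ⟨hδ, h2, hlo, hup, hv0⟩ ⟨hρpos, hρ⟩
    set v := latticeApprox δ (z 1) - latticeApprox δ (z 0) with hv
    have hvpos : (0:ℝ) < Site.supNorm v := by
      have : Site.supNorm v ≠ 0 := fun h0 => hv0 (Site.supNorm_eq_zero_iff.1 h0)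
      exact_mod_cast Nat.pos_of_ne_zero this
    have hG : c * δ / (2 * m) ≤ criticalTwoPoint 3 v := by
      have h := hcou v hv0
      rw [Site.norm_eq_supNorm] at h
      refine le_trans ?_ h
      rw [div_le_div_iff₀ (by positivity) hvpos]
      nlinarith
    have hρlow : 1 / (A * δ) ≤ ρ δ ^ 2 := by
      have h1 : (ρ δ ^ 2)⁻¹ ≤ A * δ := hρ.trans (by
        simp only [Nat.reduceSub, pow_one]
        exact mul_le_mul_of_nonneg_right (by rw [hA]; linarith [le_abs_self K₁]) hδ.le)
      rw [one_div]
      exact inv_le_of_inv_le₀ hρpos h1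
    calc c / (2 * A) / m = (1 / (A * δ)) * (c * δ / (2 * m)) := by
          field_simp
      _ ≤ ρ δ ^ 2 * criticalTwoPoint 3 v :=
          mul_le_mul hρlow hG (by positivity) hρpos.le
  · -- upper bound: ρ² ≤ K₂/δ, G ≤ C/‖v‖ ≤ 2 C δ / m
    refine le_of_tendsto hconv ?_
    filter_upwards [hgeom, hK₂] with δ ⟨hδ, h2, hlo, hup, hv0⟩ hρ
    set v := latticeApprox δ (z 1) - latticeApprox δ (z 0) with hv
    have hvpos : (0:ℝ) < Site.supNorm v := by
      have : Site.supNorm v ≠ 0 := fun h0 => hv0 (Site.supNorm_eq_zero_iff.1 h0)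
      exact_mod_cast Nat.pos_of_ne_zero this
    have hG : criticalTwoPoint 3 v ≤ 2 * (C + 1) * δ / m := by
      refine (hIR v hv0).trans ?_
      simp only [Nat.reduceSub, pow_one]
      rw [← div_eq_mul_inv, div_le_div_iff₀ hvpos hmpos]
      nlinarith [hC0, hδ]
    have hG0 : 0 ≤ criticalTwoPoint 3 v := criticalTwoPoint_nonneg' v
    calc ρ δ ^ 2 * criticalTwoPoint 3 v ≤ (K₂ / δ) * (2 * (C + 1) * δ / m) :=
          mul_le_mul hρ hG hG0 (by positivity)
      _ = 2 * K₂ * (C + 1) / m := by field_simp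

end Summit.CriticalPhenomena.Ising3DConformalLimit.CoulombImpliesNontrivialNegative

end
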